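import Mathlib
import HarnessLib
import Summits.HubbardSuperconductivity.HubbardSuperconductivity.Theorems.KLProgrammeKLRegimeEngineTowerWtAssemblyKlEngStructuralSharp
import Summits.HubbardSuperconductivity.HubbardSuperconductivity.Theorems.KLProgrammeKLRegimeEngineTowerWtBlockZeroLevelsKlEng

/-!
# ♯ RE-KEY («(b)-WT4-READOUT-CE-DIM», located by p4 g22 l.≈11700): the read-out bracket is the SHARP one (`readoutBracket_le_law_mul_sharp`): the `y`-term of `A_tot`
# is divided by `2τQ″` instead of multiplied by `ψ` (ratio `2τψQ″ ∝ (M/β)²`), so `A_tot/ε_x` is `O(1)` in `M/β` and the CE row is M-UNIFORM; nothing else changes.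
# Route `KLProgramme` — crux K3 ENGINE (stmt-HubbardSuperconductivity-20437 `KLRegimeEngineV17F2`), stub (b) v2, THE WEIGHTED HALF «(b)-WT4»:
# W12 — «(b)-WT4-ASSEMBLY-∀j» WITH THE BLOCK-0 LEVELS DISCHARGED: the weighted clause at EVERY level modulo structural E1 inputs, numerics and caps ONLY
# (cell gate-hubbard-kl, seat hubbard-kl-k3c3-p2 g17; W10 `kernelNormsWt4_all_klEng_structural` (p703207) ∘ W11b `kernelNormsWt4_blockZero_klEng (d−1)`; the
# weighted twin of p3 g22's (ℓ) `_structural`; E1 may rename or supersede)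

W10's last non-structural row — the block-0 levels `1 ≤ j < d` («WB4») — is discharged by W11b at block length `d − 1` (levels `1 ≤ j ≤ d − 1`), whose own
`Z^{K_n}_{Λ_1} ≠ 0` is again p3's `exists_partitionFn_scaleOne_ne_zero_unif` (doors folded into `c₀ U₁`).  New rows, all of W11b's classes: a SECOND block-0
name group `ᾱ₁ κ̄₁ c̄r₁ c̄c₁ W₁ Z₁ σ₁ τ₁ ψ₁ Φ₁` (equational, constants `Cκ₁ CJ₁ Cα₁` of `levelLawWt_blockZero_klEng (d−1)`), its Chernoff data `A′₁ Q′₁ ι¹` and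
ONE ∧-bundle of Chernoff/import/smallness/guard rows at every `λ_j`, `1 ≤ j ≤ d − 1` [numerics, kit currency], the read-out names `Aro₂ Qro₂ Qtot₂ Atot₂` (equational)
and their CE row at `1 ≤ j ≤ d − 1`; the level-`0` weighted datum rows (`Ab₀ Qb₀`, shared by both groups) are now asked at every rate `1 ≤ j ≤ n`, the four-leg plain
lines `S₄` and their threshold (common constant `CW₄ := max`) at every `1 ≤ j ≤ n`.
* **`kernelNormsWt4_all_klEng_closed (d R c″)`** ⊢ `∀ j ≤ n, KernelNormsWt4 L M (klWtBudget P Qe U j) β U μ (klFlowFrameU L M β U μ n) j`.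
INPUT CLASSES after this file (exhaustive): [kit currency — p3 F9″ / p4] the level-0 WEIGHTED datum of `𝒱_1` at `(F_0, rate j)`, `1 ≤ j ≤ n` (unit law `Ab₀ Qb₀`; two
groups of Chernoff rows and block-0 kit guards; the block-0 PLAIN kit guard of the Z-thread); [E1 structural] weighted plain lines of the imports (`s₂ s₄ s₆`) and cells
(`S₄ S₆`), blocking `d ≥ 2`, `B ≥ 1`; [numerics, p4] doors, the 8 kit rows at every `λ_j` (`d ≤ j`), two block-0 bundles, dominants `κb αb crb ccb`, `A′ Q″`, `Atot Qtot`,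
three CE rows, cell thresholds, `Atot₁ j ≤ Ab` (`d ≤ j ≤ n`), `Qtot₁ = Qb`; [D] caps; `Qe` a raise of `klEngQ7 P R`.  NO datum-free analytic row, no partition function,
no low level remains a hypothesis.  Bookkeeping composition of landed theorems; nothing asserts (b), WT4's rows, (ℓ), any stub, K3 or superconductivity.
References: BGM 2006 §2.3 (2.13)–(2.14), §2.7 (2.71a), §2.8 (2.76)–(2.84), (2.93)–(2.98), Lemma 2.5, §3 (3.2)–(3.8) [cite: BenfattoGiulianiMastropietro2006].
-/

noncomputable section

namespace Summit.HubbardSuperconductivity.HubbardSuperconductivity.Theorems.EngineV8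

set_option linter.dupNamespace false -- summit = problem name (single-conjunct summit), D-0017

open Classical
open Real Finset Literature.MathematicalPhysics.QuantumLattice Literature.Probability.LatticeModels GrassmannAlgebra
open Literature.MathematicalPhysics.QuantumLattice.FermiRG Literature.MathematicalPhysics.QuantumLattice.FermiRG.BGM2006Routing
open Summit.HubbardSuperconductivity.HubbardSuperconductivity.Theorems.KLProgrammeLegKernels
open Summit.HubbardSuperconductivity.HubbardSuperconductivity.Theorems.KLRegimeSplit
open Summit.HubbardSuperconductivity.HubbardSuperconductivity.Theorems.KLRegimeWick
open Summit.HubbardSuperconductivity.HubbardSuperconductivity.Theorems.TwoPointAssembly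
open Summit.HubbardSuperconductivity.HubbardSuperconductivity.Theorems.DispersionFlow
open Summit.HubbardSuperconductivity.HubbardSuperconductivity.Theorems.TorusFourierL2

variable {L M : ℕ} [NeZero L] [NeZero M]

/-! ## The weighted clause at every level, modulo structural E1 inputs, numerics and caps -/

/-- **STUB (b)'s WEIGHTED CLAUSE ON THE FLOW FRAME — EVERY LEVEL, MODULO STRUCTURAL E1 INPUTS, NUMERICS AND CAPS ONLY** (W10 ∘ W11b; see the module docstring
for the exhaustive input list); conclusion `∀ j ≤ n, KernelNormsWt4 L M (klWtBudget P Qe U j) β U μ (klFlowFrameU L M β U μ n) j`.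
[cite: BenfattoGiulianiMastropietro2006, §2.3 (2.13)-(2.14), §2.7 (2.71a), §2.8 (2.76)-(2.84), (2.93)-(2.98), Lemma 2.5 (2.98), §3 (3.2)-(3.8)] -/
theorem kernelNormsWt4_all_klEng_closed_sharp (d : ℕ) (R : RenConsts) (c'' : ℝ) (hc'' : 0 < c'') :
    ∃ C₁ C₂ Cκ Cb CJ C₁r C₂r Cκr Cbr CJr C₁i C₂i : ℝ, 0 < C₁ ∧ 0 < C₂ ∧ 0 < Cκ ∧ 0 < Cb ∧ 0 < CJ ∧
      0 < C₁r ∧ 0 < C₂r ∧ 0 < Cκr ∧ 0 < Cbr ∧ 0 < CJr ∧ 0 < C₁i ∧ 0 < C₂i ∧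
      ∃ Cinc₁ Dinc₁ : ℝ, 1 ≤ Cinc₁ ∧ 1 ≤ Dinc₁ ∧ ∃ Cκ₀ CJ₀ Cα : ℝ, 0 < Cκ₀ ∧ 0 < CJ₀ ∧ 0 < Cα ∧
      ∃ Cκz Cbz CJz : ℝ, 0 < Cκz ∧ 0 < Cbz ∧ 0 < CJz ∧ ∃ CWi CW₄ CW₆ : ℝ, 0 < CWi ∧ 0 < CW₄ ∧ 0 < CW₆ ∧
      ∃ Cinc₂ Dinc₂ : ℝ, 1 ≤ Cinc₂ ∧ 1 ≤ Dinc₂ ∧ ∃ Cκ₁ CJ₁ Cα₁ : ℝ, 0 < Cκ₁ ∧ 0 < CJ₁ ∧ 0 < Cα₁ ∧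
      (R.WF2 → ∃ c₃' : ℝ, 0 < c₃' ∧ ∃ U₀' : ℝ, 0 < U₀' ∧
      ∀ P : SplitConsts, P.WF → ∃ c₀ : ℝ, 0 < c₀ ∧ ∃ U₁ : ℝ, 0 < U₁ ∧
      ∀ (G : GeoConsts) (Q : EngConsts) (c : ℝ), 0 < c → c ≤ klEngC₃6 P R → c ≤ c₃' → c ≤ c₀ →
      ∀ μ ∈ klWindowC, ∀ U : ℝ, 0 < U → U ≤ klEngU₀9 P R c → U ≤ U₀' → U ≤ U₁ → c'' * U ≤ 1 →
      ∀ β : ℝ, klBetaMin ≤ β → β ≤ Real.exp (c / U ^ 2) →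
      ∀ (L M : ℕ) [NeZero L] [NeZero M], klEngL₃ β U ≤ L → klEngM₃ β U L ≤ M →
      ∀ n : ℕ, 1 ≤ n → n ≤ nScales β + 1 → IsKLRegime U c (-(n : ℤ)) → HistP klPredsV17F2 L M G P Q R β U μ 0 n →
        (∀ m', 1 ≤ m' → m' < n → FlowPieceOscAt L M c'' β U μ m') →
      2 ≤ d →
      -- the degree caps [choice: `exists_degreeCap`] (+ block `0`'s input family `F_0`)
      ∀ D : ℕ, 3 ≤ D → (∀ k, 1 ≤ k → d * k ≤ n → Fintype.card (SpaceTimeIdx L M × SectorLeg (sectorCount (d * k - 1))) / 2 ≤ D) →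
        Fintype.card (HubbardFieldIdx L M) ≤ 2 * D + 1 → Fintype.card (SpaceTimeIdx L M × SectorLeg (sectorCount 0)) / 2 ≤ D →
      -- the coupling amplitude and the law's constants
      ∀ (B A Q' Ab Qb : ℝ), 1 ≤ B → 0 ≤ A → 0 < Q' → 0 ≤ Ab → 0 ≤ Qb →
      -- THE LEVEL-0 WEIGHTED DATUM of `𝒱_1` at `(F_0, rate j)`, every rate `1 ≤ j ≤ n` [kit currency]; BLOCK 0's BASE LAW (p3 WB3): names (group 0), numerics at `λ_j`, `d ≤ j ≤ n`
      ∀ (Ab₀ Qb₀ : ℝ), 0 ≤ Ab₀ → 0 ≤ Qb₀ →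
      ∀ (αb₀ κb₀ crb₀ ccb₀ W₀ Z₀ σ₀ τ₀ ψ₀ Φ₀ : ℝ), αb₀ = Cα * ((M : ℝ) / β) → κb₀ = Real.sqrt (2 * Cκ₀ * klE0) → crb₀ = 81 * CJ₀ * M / β →
        ccb₀ = 162 * CJ₀ * M / β → W₀ = 32 * crb₀ / ccb₀ → Z₀ = imagTimeWeight β M ^ 2 * ccb₀ ^ 2 / 8 → σ₀ = κb₀ ^ 2 / ccb₀ ^ 2 →
        τ₀ = 4 * exp 4 * κb₀ ^ 2 / ccb₀ ^ 2 → ψ₀ = ccb₀ ^ 2 / κb₀ ^ 2 → Φ₀ = exp 1 * αb₀ * ccb₀ / (κb₀ ^ 2 * crb₀) →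
      ∀ (A'₀ Q'₀ ι₁₀ ι₂₀ ι₃₀ : ℝ), 0 ≤ A'₀ → 0 < Q'₀ →
      (∀ j, 1 ≤ j → j ≤ n → ∀ p : ℕ, 3 ≤ p →
        klTowerMeasWtAt L M β U μ (klFlowFrameU L M β U μ n) 1 1 j (2 * p) / klLevUnitF β M 0 p 0 ≤ Ab₀ * (B * epsCoupling P U j) ^ (p - 1) * Qb₀ ^ p) →
      (∀ j, d ≤ j → j ≤ n →
        (∀ m, 4 ≤ m → m ≤ D → W₀ * Z₀ ^ m * (klTowerMeasWtAt L M β U μ (klFlowFrameU L M β U μ n) 1 1 j (2 * m) / klLevUnitF β M 0 m 0) ≤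
          A'₀ * (B * epsCoupling P U j) ^ (m - 1) * Q'₀ ^ m) ∧
        W₀ * Z₀ ^ 3 * (klTowerMeasWtAt L M β U μ (klFlowFrameU L M β U μ n) 1 1 j (2 * 3) / klLevUnitF β M 0 3 0) ≤ ι₃₀ * (B * epsCoupling P U j) ^ 2 ∧
        W₀ * Z₀ ^ 1 * (klTowerMeasWtAt L M β U μ (klFlowFrameU L M β U μ n) 1 1 j (2 * 1) / klLevUnitF β M 0 1 0) ≤ ι₁₀ * (B * epsCoupling P U j) ∧
        W₀ * Z₀ ^ 2 * (klTowerMeasWtAt L M β U μ (klFlowFrameU L M β U μ n) 1 1 j (2 * 2) / klLevUnitF β M 0 2 0) ≤ ι₂₀ * (B * epsCoupling P U j) ∧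
        4 * σ₀ * (B * epsCoupling P U j) * Q'₀ < 1 ∧ 2 * (B * epsCoupling P U j) * τ₀ * Q'₀ ≤ 1 ∧ exp 1 * τ₀ * (B * epsCoupling P U j) * Q'₀ < 1 ∧
        Φ₀ * (τ₀ * (ι₁₀ * (B * epsCoupling P U j) + ι₂₀ / (2 * Q'₀) + ι₃₀ / (4 * Q'₀ ^ 2) + A'₀ * Q'₀ / 4)) < 1 ∧
        Φ₀ * (exp 1 * τ₀ * (ι₁₀ * (B * epsCoupling P U j)) + (exp 1 * τ₀) ^ 2 * (ι₂₀ * (B * epsCoupling P U j)) +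
          (exp 1 * τ₀) ^ 3 * (ι₃₀ * (B * epsCoupling P U j) ^ 2) +
          A'₀ * (exp 1 * τ₀ * Q'₀) * ((exp 1 * τ₀ * (B * epsCoupling P U j) * Q'₀) ^ 3 / (1 - exp 1 * τ₀ * (B * epsCoupling P U j) * Q'₀))) < 1 ∧
        Φ₀ * towerV D τ₀ (fun m => W₀ * Z₀ ^ m *
          (klTowerMeasWtAt L M β U μ (klFlowFrameU L M β U μ n) 1 1 j (2 * m) / klLevUnitF β M 0 m 0)) < 1) →
      ∀ (Aro₁ Qro₁ Qtot₁ : ℝ) (Atot₁ : ℕ → ℝ), Aro₁ = Cinc₁ * Ab₀ → Qro₁ = Dinc₁ * Qb₀ →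
        Qtot₁ = Dinc₁ * max 1 (max Qro₁ (max (4 * Q'₀) (2 * τ₀ * ψ₀ * Q'₀))) →
        (∀ j, Atot₁ j = Aro₁ + Cinc₁ * (A'₀ * (4 * σ₀ * (B * epsCoupling P U j) * Q'₀ / (1 - 4 * σ₀ * (B * epsCoupling P U j) * Q'₀)) +
          exp 1 * (τ₀ * (ι₁₀ * (B * epsCoupling P U j) + ι₂₀ / (2 * Q'₀) + ι₃₀ / (4 * Q'₀ ^ 2) + A'₀ * Q'₀ / 4)) *
            (Φ₀ * (τ₀ * (ι₁₀ * (B * epsCoupling P U j) + ι₂₀ / (2 * Q'₀) + ι₃₀ / (4 * Q'₀ ^ 2) + A'₀ * Q'₀ / 4)) /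
              (1 - Φ₀ * (τ₀ * (ι₁₀ * (B * epsCoupling P U j) + ι₂₀ / (2 * Q'₀) + ι₃₀ / (4 * Q'₀ ^ 2) + A'₀ * Q'₀ / 4)))) / (2 * τ₀ * Q'₀))) →
        (∀ j, d ≤ j → j ≤ n → Atot₁ j ≤ Ab) → Qtot₁ = Qb →
      -- BLOCK 0's Z-THREAD (p3 `towerZ_blockZero_klEng`): its four names and the block-0 PLAIN kit guard [numerics, kit currency; read only when `d ≤ n`]
      ∀ (κz αz crz ccz : ℝ), κz = Real.sqrt (2 * Cκz * klE0) → αz = Cbz * ((M : ℝ) / β) * (4 : ℝ) ^ d / klE0 →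
        crz = 81 * CJz * M / β → ccz = 162 * CJz * M / β →
      (d ≤ n → 9 * αz * ccz / ((27 : ℝ) ^ 5 * exp 1 * κz ^ 2 * crz) *
        towerV D (exp 2 * κz ^ 2 / ccz ^ 2)
          (fun m => 64 * (27 : ℝ) ^ 4 * exp 2 * crz / ccz * (exp 4 * ccz ^ 2 * imagTimeWeight β M ^ 2 / 8) ^ m *
            klTowerMuLevF L M β U μ (klFlowFrameU L M β U μ n) 1 1 m) < 1) →
      -- BLOCK 0's LEVELS `1 ≤ j < d` (W11b `kernelNormsWt4_blockZero_klEng (d−1)`): names (group 1, equational), Chernoff data, numerics at `λ_j`, `1 ≤ j ≤ d − 1`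
      ∀ (αb₁ κb₁ crb₁ ccb₁ W₁ Z₁ σ₁ τ₁ ψ₁ Φ₁ : ℝ), αb₁ = Cα₁ * ((M : ℝ) / β) → κb₁ = Real.sqrt (2 * Cκ₁ * klE0) → crb₁ = 81 * CJ₁ * M / β →
        ccb₁ = 162 * CJ₁ * M / β → W₁ = 32 * crb₁ / ccb₁ → Z₁ = imagTimeWeight β M ^ 2 * ccb₁ ^ 2 / 8 → σ₁ = κb₁ ^ 2 / ccb₁ ^ 2 →
        τ₁ = 4 * exp 4 * κb₁ ^ 2 / ccb₁ ^ 2 → ψ₁ = ccb₁ ^ 2 / κb₁ ^ 2 → Φ₁ = exp 1 * αb₁ * ccb₁ / (κb₁ ^ 2 * crb₁) →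
      ∀ (A'₁ Q'₁ ι₁₁ ι₂₁ ι₃₁ : ℝ), 0 ≤ A'₁ → 0 < Q'₁ →
      (∀ j, 1 ≤ j → j ≤ d - 1 → j ≤ n →
        (∀ m, 4 ≤ m → m ≤ D → W₁ * Z₁ ^ m * (klTowerMeasWtAt L M β U μ (klFlowFrameU L M β U μ n) 1 1 j (2 * m) / klLevUnitF β M 0 m 0) ≤
          A'₁ * (B * epsCoupling P U j) ^ (m - 1) * Q'₁ ^ m) ∧
        W₁ * Z₁ ^ 3 * (klTowerMeasWtAt L M β U μ (klFlowFrameU L M β U μ n) 1 1 j (2 * 3) / klLevUnitF β M 0 3 0) ≤ ι₃₁ * (B * epsCoupling P U j) ^ 2 ∧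
        W₁ * Z₁ ^ 1 * (klTowerMeasWtAt L M β U μ (klFlowFrameU L M β U μ n) 1 1 j (2 * 1) / klLevUnitF β M 0 1 0) ≤ ι₁₁ * (B * epsCoupling P U j) ∧
        W₁ * Z₁ ^ 2 * (klTowerMeasWtAt L M β U μ (klFlowFrameU L M β U μ n) 1 1 j (2 * 2) / klLevUnitF β M 0 2 0) ≤ ι₂₁ * (B * epsCoupling P U j) ∧
        4 * σ₁ * (B * epsCoupling P U j) * Q'₁ < 1 ∧ 2 * (B * epsCoupling P U j) * τ₁ * Q'₁ ≤ 1 ∧ exp 1 * τ₁ * (B * epsCoupling P U j) * Q'₁ < 1 ∧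
        Φ₁ * (τ₁ * (ι₁₁ * (B * epsCoupling P U j) + ι₂₁ / (2 * Q'₁) + ι₃₁ / (4 * Q'₁ ^ 2) + A'₁ * Q'₁ / 4)) < 1 ∧
        Φ₁ * (exp 1 * τ₁ * (ι₁₁ * (B * epsCoupling P U j)) + (exp 1 * τ₁) ^ 2 * (ι₂₁ * (B * epsCoupling P U j)) +
          (exp 1 * τ₁) ^ 3 * (ι₃₁ * (B * epsCoupling P U j) ^ 2) +
          A'₁ * (exp 1 * τ₁ * Q'₁) * ((exp 1 * τ₁ * (B * epsCoupling P U j) * Q'₁) ^ 3 / (1 - exp 1 * τ₁ * (B * epsCoupling P U j) * Q'₁))) < 1 ∧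
        Φ₁ * towerV D τ₁ (fun m => W₁ * Z₁ ^ m *
          (klTowerMeasWtAt L M β U μ (klFlowFrameU L M β U μ n) 1 1 j (2 * m) / klLevUnitF β M 0 m 0)) < 1) →
      ∀ (Aro₂ Qro₂ Qtot₂ : ℝ) (Atot₂ : ℕ → ℝ), Aro₂ = Cinc₂ * Ab₀ → Qro₂ = Dinc₂ * Qb₀ →
        Qtot₂ = Dinc₂ * max 1 (max Qro₂ (max (4 * Q'₁) (2 * τ₁ * ψ₁ * Q'₁))) →
        (∀ j, Atot₂ j = Aro₂ + Cinc₂ * (A'₁ * (4 * σ₁ * (B * epsCoupling P U j) * Q'₁ / (1 - 4 * σ₁ * (B * epsCoupling P U j) * Q'₁)) +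
          exp 1 * (τ₁ * (ι₁₁ * (B * epsCoupling P U j) + ι₂₁ / (2 * Q'₁) + ι₃₁ / (4 * Q'₁ ^ 2) + A'₁ * Q'₁ / 4)) *
            (Φ₁ * (τ₁ * (ι₁₁ * (B * epsCoupling P U j) + ι₂₁ / (2 * Q'₁) + ι₃₁ / (4 * Q'₁ ^ 2) + A'₁ * Q'₁ / 4)) /
              (1 - Φ₁ * (τ₁ * (ι₁₁ * (B * epsCoupling P U j) + ι₂₁ / (2 * Q'₁) + ι₃₁ / (4 * Q'₁ ^ 2) + A'₁ * Q'₁ / 4)))) / (2 * τ₁ * Q'₁))) →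
      -- dominants of the LINK's and of the read-out's constants, and the names
      ∀ (κb αb crb ccb : ℝ), Real.sqrt (2 * Cκ * klE0) ≤ κb → Cb * ((M : ℝ) / β) * (4 : ℝ) ^ d / klE0 ≤ αb →
        81 * CJ * M / β ≤ crb → 162 * CJ * M / β ≤ ccb →
        Real.sqrt (2 * Cκr * klE0) ≤ κb → Cbr * ((M : ℝ) / β) * (4 : ℝ) ^ d / klE0 ≤ αb → 81 * CJr * M / β ≤ crb → 162 * CJr * M / β ≤ ccb →
      ∀ (W Z σ τ ψ Φ : ℝ),
        W = 32 * crb / ccb → Z = imagTimeWeight β M ^ 2 * ccb ^ 2 / 8 →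
        σ = κb ^ 2 / ccb ^ 2 → τ = 4 * exp 4 * κb ^ 2 / ccb ^ 2 → ψ = ccb ^ 2 / κb ^ 2 → Φ = exp 1 * αb * ccb / (κb ^ 2 * crb) →
      ∀ (A' Q'' : ℝ),
        W * ((C₁ / C₂) * (8 : ℝ) ^ (d - 1) * (Ab + A / (1 - ((2 : ℝ) ^ d)⁻¹))) ≤ A' →
        Z * (C₂ ^ 2 * ((2 : ℝ) ^ (d - 1))⁻¹ * max Q' Qb) ≤ Q'' → W * Ab ≤ A' → Z * Qb ≤ Q'' → 0 < Q'' →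
      -- the weighted IMPORTS: `klScaleWt_j`-weighted PLAIN two-, four- and six-leg pinned lines of `𝒱_{dk}[K_n]`, every block `d·k ≤ j`, every rate `d ≤ j ≤ n` [E1]
      ∀ (s₂ s₄ s₆ : ℝ), 0 ≤ s₂ → 0 ≤ s₄ → 0 ≤ s₆ →
      (∀ j, d ≤ j → j ≤ n → ∀ k, 1 ≤ k → d * k ≤ j → ∀ (q : Fin 2) (τ' : Fin 2 → SectorLeg 1) (y' : SpaceTimeIdx L M),
        imagTimeWeight β M ^ 1 * ∑ x' ∈ univ.filter (fun x' : Fin 2 → SpaceTimeIdx L M => x' q = y'),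
          klScaleWt L M β j ((univ.image x').image (fun x : SpaceTimeIdx L M => (((((2 * (x.1 : ℕ) : ℕ)) : ZMod (2 * (2 * M)))), x.2))) *
            ‖sectorisedKernel L M β (trivialMultiplier L M) (klTowerInput L M β U μ (klFlowFrameU L M β U μ n) d k) 2 τ' x'‖ ≤
          s₂ * ((4 : ℝ) ^ (d * k - 1))⁻¹ * (B * epsCoupling P U j)) →
      (∀ j, d ≤ j → j ≤ n → ∀ k, 1 ≤ k → d * k ≤ j → ∀ (q : Fin 4) (τ' : Fin 4 → SectorLeg 1) (y' : SpaceTimeIdx L M),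
        imagTimeWeight β M ^ 3 * ∑ x' ∈ univ.filter (fun x' : Fin 4 → SpaceTimeIdx L M => x' q = y'),
          klScaleWt L M β j ((univ.image x').image (fun x : SpaceTimeIdx L M => (((((2 * (x.1 : ℕ) : ℕ)) : ZMod (2 * (2 * M)))), x.2))) *
            ‖sectorisedKernel L M β (trivialMultiplier L M) (klTowerInput L M β U μ (klFlowFrameU L M β U μ n) d k) 4 τ' x'‖ ≤ s₄ * (B * epsCoupling P U j)) →
      (∀ j, d ≤ j → j ≤ n → ∀ k, 1 ≤ k → d * k ≤ j → ∀ (q : Fin 6) (τ' : Fin 6 → SectorLeg 1) (y' : SpaceTimeIdx L M),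
        imagTimeWeight β M ^ 5 * ∑ x' ∈ univ.filter (fun x' : Fin 6 → SpaceTimeIdx L M => x' q = y'),
          klScaleWt L M β j ((univ.image x').image (fun x : SpaceTimeIdx L M => (((((2 * (x.1 : ℕ) : ℕ)) : ZMod (2 * (2 * M)))), x.2))) *
            ‖sectorisedKernel L M β (trivialMultiplier L M) (klTowerInput L M β U μ (klFlowFrameU L M β U μ n) d k) 6 τ' x'‖ ≤ s₆ * (B * epsCoupling P U j) ^ 2) →
      -- the import amplitudes they induce (equational binders, k3c2-p3's `importBindersWt_of_wplainLines_flow_all`)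
      ∀ (i₁ i₂ x₆ ι₁ ι₂ ι₃ : ℝ), i₁ = 2 * W * Z * klThinCount2C * CWi ^ 2 * s₂ → i₂ = 16 * W * Z ^ 2 * klThinCountC * CWi ^ 4 * s₄ →
        x₆ = 131072 * W * Z ^ 3 * klThinCount6C * CWi ^ 6 * s₆ →
        ι₁ = i₁ * ((M : ℝ) / β) → ι₂ = i₂ * ((M : ℝ) / β) ^ 3 → ι₃ = x₆ * ((M : ℝ) / β) ^ 5 →
      -- the kit's numerics at every read-out rate [p4 «part 4»]
      (∀ j, d ≤ j → j ≤ n →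
        4 * σ * (B * epsCoupling P U j) * Q'' < 1 ∧ 2 * (B * epsCoupling P U j) * τ * Q'' ≤ 1 ∧ exp 1 * τ * (B * epsCoupling P U j) * Q'' < 1 ∧
        Φ * (τ * (ι₁ * (B * epsCoupling P U j) + ι₂ / (2 * Q'') + ι₃ / (4 * Q'' ^ 2) + A' * Q'' / 4)) < 1 ∧
        Φ * (exp 1 * τ * (ι₁ * (B * epsCoupling P U j)) + (exp 1 * τ) ^ 2 * (ι₂ * (B * epsCoupling P U j)) +
          (exp 1 * τ) ^ 3 * (ι₃ * (B * epsCoupling P U j) ^ 2) +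
          A' * (exp 1 * τ * Q'') * ((exp 1 * τ * (B * epsCoupling P U j) * Q'') ^ 3 / (1 - exp 1 * τ * (B * epsCoupling P U j) * Q''))) < 1 ∧
        4 * Q'' ≤ Q' ∧ 2 * τ * ψ * Q'' ≤ Q' ∧
        A' * (4 * Q'') ^ 3 * (4 * σ * (B * epsCoupling P U j) * Q'' / (1 - 4 * σ * (B * epsCoupling P U j) * Q'')) +
          exp 1 * ψ * (2 * τ * ψ * Q'') ^ 2 * (τ * (ι₁ * (B * epsCoupling P U j) + ι₂ / (2 * Q'') + ι₃ / (4 * Q'' ^ 2) + A' * Q'' / 4)) *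
            (Φ * (τ * (ι₁ * (B * epsCoupling P U j) + ι₂ / (2 * Q'') + ι₃ / (4 * Q'' ^ 2) + A' * Q'' / 4)) /
              (1 - Φ * (τ * (ι₁ * (B * epsCoupling P U j) + ι₂ / (2 * Q'') + ι₃ / (4 * Q'' ^ 2) + A' * Q'' / 4)))) ≤ A * Q' ^ 3) →
      -- the read-out constants level by level and the budget package's `CE` row [p4]
      ∀ (Qe : EngConsts) (Atot Qtot : ℕ → ℝ),
        (∀ j, Qtot j = max 1 (C₂i ^ 2) * max 1 (max (C₂r ^ 2 * max Q' Qb) (max (4 * Q'') (2 * τ * ψ * Q'')))) →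
        (∀ j, Atot j = C₁r / C₂r * (Ab + A) + C₁i / C₂i * (A' * (4 * σ * (B * epsCoupling P U j) * Q'' / (1 - 4 * σ * (B * epsCoupling P U j) * Q'')) +
          exp 1 * (τ * (ι₁ * (B * epsCoupling P U j) + ι₂ / (2 * Q'') + ι₃ / (4 * Q'' ^ 2) + A' * Q'' / 4)) *
            (Φ * (τ * (ι₁ * (B * epsCoupling P U j) + ι₂ / (2 * Q'') + ι₃ / (4 * Q'' ^ 2) + A' * Q'' / 4)) /
              (1 - Φ * (τ * (ι₁ * (B * epsCoupling P U j) + ι₂ / (2 * Q'') + ι₃ / (4 * Q'' ^ 2) + A' * Q'' / 4)))) / (2 * τ * Q''))) →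
        (∀ j, d ≤ j → j ≤ n → Qtot j * imagTimeWeight β M ^ 2 * B * max 1 (Atot j / imagTimeWeight β M) ≤ Qe.CE) →
        (∀ j, 1 ≤ j → j ≤ d - 1 → j ≤ n → Qtot₂ * imagTimeWeight β M ^ 2 * B * max 1 (Atot₂ j / imagTimeWeight β M) ≤ Qe.CE) →
        (klEngQ7 P R).IsRaiseOf Qe →
      -- the import CELLS: `m = 4` at every `1 ≤ j ≤ n`, `m = 6` at `d ≤ j ≤ n` — weighted PLAIN four- and six-leg pinned lines of `𝒱_j[K_n]` at `(F_j, rate j)` [E1] + thresholds [numerics]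
      ∀ (S₄ S₆ : ℕ → ℝ), (∀ j, 0 ≤ S₄ j) → (∀ j, 0 ≤ S₆ j) →
      (∀ j, 1 ≤ j → j ≤ n → ∀ (q : Fin 4) (τ' : Fin 4 → SectorLeg 1) (y' : SpaceTimeIdx L M),
        imagTimeWeight β M ^ 3 * ∑ x' ∈ univ.filter (fun x' : Fin 4 → SpaceTimeIdx L M => x' q = y'),
          klScaleWt L M β j ((univ.image x').image (fun x : SpaceTimeIdx L M => (((((2 * (x.1 : ℕ) : ℕ)) : ZMod (2 * (2 * M)))), x.2))) *
            ‖sectorisedKernel L M β (trivialMultiplier L M) (klEffectiveAction L M β U μ (klFlowFrameU L M β U μ n) klE0 j) 4 τ' x'‖ ≤ S₄ j) →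
      (∀ j, d ≤ j → j ≤ n → ∀ (q : Fin 6) (τ' : Fin 6 → SectorLeg 1) (y' : SpaceTimeIdx L M),
        imagTimeWeight β M ^ 5 * ∑ x' ∈ univ.filter (fun x' : Fin 6 → SpaceTimeIdx L M => x' q = y'),
          klScaleWt L M β j ((univ.image x').image (fun x : SpaceTimeIdx L M => (((((2 * (x.1 : ℕ) : ℕ)) : ZMod (2 * (2 * M)))), x.2))) *
            ‖sectorisedKernel L M β (trivialMultiplier L M) (klEffectiveAction L M β U μ (klFlowFrameU L M β U μ n) klE0 j) 6 τ' x'‖ ≤ S₆ j) →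
      (∀ j, 1 ≤ j → j ≤ n → klThinCountC * sectorCount j * (CW₄ ^ 4 * S₄ j) ≤ klWtBudget P Qe U j 4) →
      (∀ j, d ≤ j → j ≤ n → klThinCount6C * (Fintype.card (SectorLeg (sectorCount j)) : ℝ) ^ 4 * (CW₆ ^ 6 * S₆ j) ≤ klWtBudget P Qe U j 6) →
      ∀ j, j ≤ n → KernelNormsWt4 L M (klWtBudget P Qe U j) β U μ (klFlowFrameU L M β U μ n) j) := by
  obtain ⟨C₁, C₂, Cκ, Cb, CJ, C₁r, C₂r, Cκr, Cbr, CJr, C₁i, C₂i, hC₁, hC₂, hCκ, hCb, hCJ, hC₁r, hC₂r, hCκr, hCbr, hCJr, hC₁i, hC₂i,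
    Cinc₁, Dinc₁, hCinc₁, hDinc₁, Cκ₀, CJ₀, Cα, hCκ₀, hCJ₀, hCα, Cκz, Cbz, CJz, hCκz, hCbz, hCJz, CWi, CW₄, CW₆, hCWi, hCW₄, hCW₆, hall⟩ :=
    kernelNormsWt4_all_klEng_structural_sharp d R c'' hc''
  obtain ⟨Cinc₂, Dinc₂, hCinc₂, hDinc₂, Cκ₁, CJ₁, Cα₁, hCκ₁, hCJ₁, hCα₁, CW₄b, hCW₄b, hbz⟩ := kernelNormsWt4_blockZero_klEng (d - 1) R c'' hc''
  refine ⟨C₁, C₂, Cκ, Cb, CJ, C₁r, C₂r, Cκr, Cbr, CJr, C₁i, C₂i, hC₁, hC₂, hCκ, hCb, hCJ, hC₁r, hC₂r, hCκr, hCbr, hCJr, hC₁i, hC₂i,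
    Cinc₁, Dinc₁, hCinc₁, hDinc₁, Cκ₀, CJ₀, Cα, hCκ₀, hCJ₀, hCα, Cκz, Cbz, CJz, hCκz, hCbz, hCJz, CWi, max CW₄ CW₄b, CW₆, hCWi,
    lt_max_iff.2 (Or.inl hCW₄), hCW₆, Cinc₂, Dinc₂, hCinc₂, hDinc₂, Cκ₁, CJ₁, Cα₁, hCκ₁, hCJ₁, hCα₁, fun hR2 => ?_⟩
  obtain ⟨c₃a, hc₃a, U₀a, hU₀a, hall'⟩ := hall hR2
  obtain ⟨c₃b, hc₃b, U₀b, hU₀b, hbz'⟩ := hbz hR2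
  refine ⟨min c₃a c₃b, lt_min hc₃a hc₃b, min U₀a U₀b, lt_min hU₀a hU₀b, fun P hP => ?_⟩
  obtain ⟨c₀, hc₀, U₁, hU₁, hall''⟩ := hall' P hP
  obtain ⟨c₀', hc₀', U₁', hU₁', hZ1'⟩ := exists_partitionFn_scaleOne_ne_zero_unif P R hR2
  refine ⟨min c₀ c₀', lt_min hc₀ hc₀', min U₁ U₁', lt_min hU₁ hU₁', ?_⟩
  intro G Q c hc hc6 hc₃' hcc₀ μ hμ U hU hU9 hU₀' hUU₁ hcU β hβmin hβc L M _ _ hL3 hM3 n hn1 hnN hkl hhist hosc hd D hD3 hD hcard hD0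
    B A Q' Ab Qb hB hA hQ hAb hQb Ab₀ Qb₀ hAb₀ hQb₀ αb₀ κb₀ crb₀ ccb₀ W₀ Z₀ σ₀ τ₀ ψ₀ Φ₀ hαb₀ hκb₀ hcrb₀ hccb₀ hW₀ hZ₀ hσ₀ hτ₀ hψ₀ hΦ₀
    A'₀ Q'₀ ι₁₀ ι₂₀ ι₃₀ hA'₀ hQ'₀ hlawb₀ hblk0 Aro₁ Qro₁ Qtot₁ Atot₁ hAro₁ hQro₁ hQtot₁ hAtot₁ hAtotle hQtotQb
    κz αz crz ccz hκz hαz hcrz hccz hguardz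
    αb₁ κb₁ crb₁ ccb₁ W₁ Z₁ σ₁ τ₁ ψ₁ Φ₁ hαb₁ hκb₁ hcrb₁ hccb₁ hW₁ hZ₁eq hσ₁ hτ₁ hψ₁ hΦ₁ A'₁ Q'₁ ι₁₁ ι₂₁ ι₃₁ hA'₁ hQ'₁ hblk1
    Aro₂ Qro₂ Qtot₂ Atot₂ hAro₂ hQro₂ hQtot₂ hAtot₂
    κb αb crb ccb hκb hαb hcrb hccb hκbr hαbr hcrbr hccbr W Z σ τ ψ Φ hW hZ' hσ hτ hψ hΦ
    A' Q'' hA'1 hQ'1 hA'2 hQ'2 hQ'0 s₂ s₄ s₆ hs₂ hs₄ hs₆ hS₂ hS₄ hS₆ i₁ i₂ x₆ ι₁ ι₂ ι₃ hi₁ hi₂ hx₆ hι₁ hι₂ hι₃ hnum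
    Qe Atot Qtot hQtot hAtot hCE hCE₂ hQe S₄ S₆ hS₄0 hS₆0 hL4 hL6 hT4 hT6 j hjn
  -- the folded doors
  have hc₃a' : c ≤ c₃a := hc₃'.trans (min_le_left _ _)
  have hc₃b' : c ≤ c₃b := hc₃'.trans (min_le_right _ _)
  have hU₀a' : U ≤ U₀a := hU₀'.trans (min_le_left _ _)
  have hU₀b' : U ≤ U₀b := hU₀'.trans (min_le_right _ _)
  have hcc₀a : c ≤ c₀ := hcc₀.trans (min_le_left _ _)
  have hcc₀b : c ≤ c₀' := hcc₀.trans (min_le_right _ _)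
  have hUU₁a : U ≤ U₁ := hUU₁.trans (min_le_left _ _)
  have hUU₁b : U ≤ U₁' := hUU₁.trans (min_le_right _ _)
  have hβ : 0 < β := KLRegimeSplit.pos_of_klBetaMin_le hβmin
  have hfr : FrameOK R U (nScales β) μ (klFlowFrameU L M β U μ n) := frameOK_klFlowFrameU_of_histP_le hR2 hn1 le_rfl hnN hhist
  set K : TrigPolyC4v := klFlowFrameU L M β U μ n with hKdef
  have hZ1 : hubbardEffPartitionFnCT L M β U μ 0 K (klScale klE0 1) ≠ 0 :=
    hZ1' c hc hcc₀b μ hμ U hU hU9 hUU₁b β hβmin hβc L M hL3 hM3 K hfr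
  -- the threshold at the common four-leg constant `max CW₄ CW₄b`
  have hS4mono : ∀ (C : ℝ), 0 ≤ C → C ≤ max CW₄ CW₄b → ∀ j, 1 ≤ j → j ≤ n →
      klThinCountC * sectorCount j * (C ^ 4 * S₄ j) ≤ klWtBudget P Qe U j 4 := by
    intro C hC0 hC j hj1 hjn
    refine le_trans ?_ (hT4 j hj1 hjn)
    have hNc : 0 ≤ klThinCountC * (sectorCount j : ℝ) := mul_nonneg klThinCountC_pos.le (Nat.cast_nonneg _)
    exact mul_le_mul_of_nonneg_left (mul_le_mul_of_nonneg_right (pow_le_pow_left₀ hC0 hC 4) (hS₄0 j)) hNc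
  -- the block-0 levels `1 ≤ j ≤ d − 1` (W11b at `d − 1`)
  have hlow' : ∀ j, 1 ≤ j → j < d → j ≤ n → KernelNormsWt4 L M (klWtBudget P Qe U j) β U μ K j :=
    fun j hj1 hjd hjn => hbz' G P Q c hP hc hc6 hc₃b' μ hμ U hU hU9 hU₀b' hcU β hβmin hβc L M hL3 hM3 n hn1 hnN hkl hhist hosc hZ1 D hD0 hcard
      B Ab₀ Qb₀ hB hAb₀ hQb₀ αb₁ κb₁ crb₁ ccb₁ W₁ Z₁ σ₁ τ₁ ψ₁ Φ₁ hαb₁ hκb₁ hcrb₁ hccb₁ hW₁ hZ₁eq hσ₁ hτ₁ hψ₁ hΦ₁ A'₁ Q'₁ ι₁₁ ι₂₁ ι₃₁ hA'₁ hQ'₁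
      (fun j hj1 _ hjn => hlawb₀ j hj1 hjn) hblk1 Aro₂ Qro₂ Qtot₂ Atot₂ hAro₂ hQro₂ hQtot₂ hAtot₂ Qe hCE₂ S₄ hS₄0
      (fun j hj1 _ hjn => hL4 j hj1 hjn) (fun j hj1 _ hjn => hS4mono CW₄b hCW₄b.le (le_max_right _ _) j hj1 hjn) j hj1 (by omega) hjn
  exact hall'' G Q c hc hc6 hc₃a' hcc₀a μ hμ U hU hU9 hU₀a' hUU₁a hcU β hβmin hβc L M hL3 hM3 n hn1 hnN hkl hhist hosc hd D hD3 hD hcard hD0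
    B A Q' Ab Qb hB hA hQ hAb hQb Ab₀ Qb₀ hAb₀ hQb₀ αb₀ κb₀ crb₀ ccb₀ W₀ Z₀ σ₀ τ₀ ψ₀ Φ₀ hαb₀ hκb₀ hcrb₀ hccb₀ hW₀ hZ₀ hσ₀ hτ₀ hψ₀ hΦ₀
    A'₀ Q'₀ ι₁₀ ι₂₀ ι₃₀ hA'₀ hQ'₀ (fun j hjd hjn => hlawb₀ j (by omega) hjn) hblk0 Aro₁ Qro₁ Qtot₁ Atot₁ hAro₁ hQro₁ hQtot₁ hAtot₁ hAtotle hQtotQb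
    κz αz crz ccz hκz hαz hcrz hccz hguardz
    κb αb crb ccb hκb hαb hcrb hccb hκbr hαbr hcrbr hccbr W Z σ τ ψ Φ hW hZ' hσ hτ hψ hΦ
    A' Q'' hA'1 hQ'1 hA'2 hQ'2 hQ'0 s₂ s₄ s₆ hs₂ hs₄ hs₆ hS₂ hS₄ hS₆ i₁ i₂ x₆ ι₁ ι₂ ι₃ hi₁ hi₂ hx₆ hι₁ hι₂ hι₃ hnum
    Qe Atot Qtot hQtot hAtot hCE hQe S₄ S₆ hS₄0 hS₆0 (fun j hjd hjn => hL4 j (by omega) hjn) hL6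
    (fun j hjd hjn => hS4mono CW₄ hCW₄.le (le_max_left _ _) j (by omega) hjn) hT6 hlow' j hjn

end Summit.HubbardSuperconductivity.HubbardSuperconductivity.Theorems.EngineV8

end
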